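import Literature.AlgebraicGeometry.Motives.CartierDivisorSameDivisorIdealSheaf
import Literature.AlgebraicGeometry.Motives.CartierDivisorSubschemeReduced
import Literature.AlgebraicGeometry.Resolution.MarkedIdealsLemmas
import Literature.AlgebraicGeometry.Resolution.AlterationsNodalBoundary
import Literature.AlgebraicGeometry.Motives.AbelianVarietyAmpleProofs
import Literature.AlgebraicGeometry.Motives.VarietiesRegularProofs
import HarnessLib

/-!
# An effective Cartier divisor with reduced closed subscheme and irreducible support has multiplicity one

Layer `Literature/AlgebraicGeometry/Motives` (namespaces `….Motives.CartierDivisor`, `….Motives.AbelianVariety`; one `Resolution` lemma).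
KERNEL ONLY (theorems; no definition, no named fact, no instance, no `sorry`).

Hartshorne II.6, Prop. 6.11 / Görtz–Wedhorn I Thm. 11.40 (2): on a regular (locally factorial) integral Noetherian scheme `X` an effective Cartier
divisor `D` with irreducible support `X ∖ X_1 = cl{η}` is `a · [cl η]` for the prime divisor `[cl η]` and some `a ≥ 1` (★ p765317
`CartierDivisor.IsEffective.exists_sameDivisor_smul_of_support_eq_closure`), i.e. `𝒪_X(−D) = 𝓘_{cl η}^a`.  The closed subscheme `Z(D) = V(𝒪_X(−D))`
(★ `IsEffective.idealSheaf`, Mathlib `IdealSheafData.subscheme`) is REDUCED iff `𝒪_X(−D)` is a radical ideal sheaf (★ p766674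
`isRadical_ideal_of_isReduced_subscheme`, ★ `Resolution.radical_eq_of_isReduced_subscheme`), and `rad(𝓘^a) = 𝓘`; so

  **`Z(D)` reduced ⇒ `𝒪_X(−D) = 𝓘_{cl η}`, i.e. `D ≈ [cl η]` has MULTIPLICITY ONE** (§2 `IsEffective.idealSheaf_eq_primeDivisorIdeal_of_isReduced`,
  `IsEffective.sameDivisor_prime_of_isReduced`);

two such divisors with the same support are the same divisor (`sameDivisor_of_isReduced_of_support_eq`), and such a `D` is not a proper
multiple of an effective divisor (`IsEffective.eq_one_of_sameDivisor_smul_of_isReduced`; the numerical input is §1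
`Resolution.primeDivisorIdeal_pow_eq_self_imp`: `𝓘_{cl η}^n = 𝓘_{cl η} ⇒ n = 1`, read in the stalk at the codimension-one point `η`, where
`𝔪_η^n = 𝔪_η` forces `n = 1` by Nakayama, ★ `maximalIdeal_pow_succ_ne`).  §3: the same on an abelian variety over a field (regular, integral,
Noetherian) — the PRINCIPALITY-FREE twin of ★ p765111 `AbelianVariety.eq_one_of_isPrincipalPolarizationDivisor_smul`.

Use (cell `hodgecm-mathlib`, D-0151; crux HLiu418 = stmt-HodgeConjecture-24832): pen ruling #9 (c) (V7-b) «re-key the Step-I transport / `hmult`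
from `h2 : IsPrincipalPolarizationDivisor Θ` to multiplicity one ∕ `Z(Θ)` reduced» (VI-7 side road; A-p07 (g14) 2026-08-30 «reducedness as the
primary head»).  COUNT-NEUTRAL.  HC_CM is proved only modulo the 7 printed citations until rung 0 closes; this file moves no book by itself.

## References
* [Hartshorne1977] R. Hartshorne, *Algebraic Geometry* (1977), II.6 Prop. 6.11 and Remark 6.11.2 (pp. 141–142); II Example 3.2.6.
* [GortzWedhorn2020] U. Görtz, T. Wedhorn, *Algebraic Geometry I*, 2nd ed. (2020), Thm. 11.40 (2), Remark 11.27 (p. 305), Def. 11.20 (p. 301).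
* [Matsumura1987] H. Matsumura, *Commutative Ring Theory* (1987), Thm. 2.2 (Nakayama) and Thm. 11.1–11.2 (discrete valuation rings).
-/

set_option autoImplicit false

noncomputable section

universe u

open CategoryTheory AlgebraicGeometry TopologicalSpace Opposite IsLocalRing

/-! ## §1 Radical ideal sheaves; `𝓘_{cl η}^n = 𝓘_{cl η} ⇒ n = 1` -/

namespace Literature.AlgebraicGeometry.Resolution

open Scheme.IdealSheafData

variable {X : Scheme.{u}}

/-- The prime divisor ideal `𝓘_{cl η}` (a vanishing ideal sheaf) is radical. [cite: Hartshorne1977, II Example 3.2.6] -/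
theorem primeDivisorIdeal_radical (η : X) : (primeDivisorIdeal η).radical = primeDivisorIdeal η := by
  refine le_antisymm (fun U => ?_) (le_radical _)
  rw [primeDivisorIdeal, radical_ideal, vanishingIdeal_ideal]
  exact (PrimeSpectrum.isRadical_vanishingIdeal _).radical_le_iff.mpr le_rfl

/-- `rad(Iⁿ) = rad(I)` for ideal sheaves (`n ≠ 0`; affine-locally Mathlib `Ideal.radical_pow`). [folklore] -/
private theorem radical_pow_eq_radical (I : X.IdealSheafData) {n : ℕ} (hn : n ≠ 0) : (I ^ n).radical = I.radical := by
  ext U : 2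
  rw [radical_ideal, radical_ideal, ideal_pow, Pi.pow_apply]
  exact Ideal.radical_pow _ hn

/-- **`𝓘_{cl η}^n = 𝓘_{cl η}` forces `n = 1`** for a codimension-one point `η` of an integral locally Noetherian scheme (`n ≥ 1`): in the stalk at
`η`, `𝔪_η^n = 𝔪_η` (★ `stalkIdeal_pow`, ★ `stalkIdeal_primeDivisorIdeal_self`), and `𝔪_η² ≠ 𝔪_η` in the Noetherian local domain `𝒪_{X,η}`, which is
not a field (★ `not_isField_stalk_of_coheight_eq_one`, ★ `maximalIdeal_pow_succ_ne`, Nakayama). [cite: Matsumura1987, Thm. 2.2 (Nakayama)] -/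
theorem primeDivisorIdeal_pow_eq_self_imp [IsIntegral X] [IsLocallyNoetherian X] {η : X} (hη : Order.coheight η = 1) {n : ℕ} (hn : 0 < n)
    (h : primeDivisorIdeal η ^ n = primeDivisorIdeal η) : n = 1 := by
  by_contra hne
  have h2 : 2 ≤ n := by omega
  have hst : maximalIdeal (X.presheaf.stalk η) ^ n = maximalIdeal (X.presheaf.stalk η) := by
    rw [← stalkIdeal_primeDivisorIdeal_self, ← stalkIdeal_pow, h]
  -- squeeze: `𝔪 = 𝔪ⁿ ≤ 𝔪² ≤ 𝔪`
  have hsq : maximalIdeal (X.presheaf.stalk η) ^ 2 = maximalIdeal (X.presheaf.stalk η) := by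
    refine le_antisymm (Ideal.pow_le_self two_ne_zero) ?_
    calc maximalIdeal (X.presheaf.stalk η) = maximalIdeal (X.presheaf.stalk η) ^ n := hst.symm
      _ ≤ maximalIdeal (X.presheaf.stalk η) ^ 2 := Ideal.pow_le_pow_right h2
  exact maximalIdeal_pow_succ_ne (not_isField_stalk_of_coheight_eq_one hη) 1 (by rw [pow_one]; exact hsq)

end Literature.AlgebraicGeometry.Resolution

namespace Literature.AlgebraicGeometry.Motives

namespace CartierDivisor

open RatFn Literature.AlgebraicGeometry.Resolution

variable {X : Scheme.{u}} [IsIntegral X] {D E : CartierDivisor X}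

/-! ## §2 Reduced `Z(D)` with irreducible support ⇒ `D ≈ [supp D]` -/

/-- `SameDivisor` is compatible with multiples: `D ≈ E ⇒ m • D ≈ m • E` (`(f_i/g_j)^m` is a unit where `f_i/g_j` is).
[cite: GortzWedhorn2020, Def. 11.20 (p. 301)] -/
theorem SameDivisor.smul (h : D.SameDivisor E) (m : ℕ) : (m • D).SameDivisor (m • E) := fun i j x hi hj => by
  rw [smul_f, smul_f, ← div_pow]
  exact (h i j x hi hj).pow m

/-- An effective presentation of the same divisor as an effective `D` with reduced `Z(D)` has reduced `Z` too (same ideal sheaf, ★ (j1)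
`SameDivisor.idealSheaf_eq`). [cite: GortzWedhorn2020, Remark 11.27 (p. 305)] -/
theorem SameDivisor.isReduced_subscheme_idealSheaf (h : D.SameDivisor E) (hD : D.IsEffective) (hE : E.IsEffective)
    [IsReduced hD.idealSheaf.subscheme] : IsReduced hE.idealSheaf.subscheme := by
  rw [← h.idealSheaf_eq hD hE]
  infer_instance

/-- **`Z(D)` reduced with irreducible support ⇒ `Z(D)` integral** (radical ideal sheaf with irreducible support `X ∖ X_1`; no regularity needed).
[cite: GortzWedhorn2020, Prop. 3.27 (p. 79)] -/
theorem IsEffective.isIntegral_subscheme_idealSheaf_of_isReduced (hD : D.IsEffective) [IsReduced hD.idealSheaf.subscheme]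
    (hirr : IsIrreducible (D.nonvanishing 1)ᶜ) : IsIntegral hD.idealSheaf.subscheme := by
  refine Morphisms.isIntegral_subscheme _ (radical_eq_of_isReduced_subscheme _) ?_
  rw [hD.coe_support_idealSheaf]
  exact hirr

section Regular

variable [IsNoetherian X]

/-- **`Z(D)` reduced ⇒ `𝒪_X(−D) = 𝓘_{supp D}`** for an effective Cartier divisor with irreducible support `X ∖ X_1 = cl{η}` on a regular integral
Noetherian scheme: `𝒪(−D) = 𝓘^a` (`a ≥ 1`, ★ p765317 + ★ (j1) `idealSheaf_eq_pow_of_smul_ofIsEffectiveCartier`) is radical, and `rad(𝓘^a) = 𝓘`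
(Mathlib `IdealSheafData.radical_pow`). Hartshorne II.6.11 with coefficient one. [cite: Hartshorne1977, II.6 Prop. 6.11 and Remark 6.11.2 (pp. 141–142)]
[cite: GortzWedhorn2020, Thm. 11.40 (2)] -/
theorem IsEffective.idealSheaf_eq_primeDivisorIdeal_of_isReduced (hX : Scheme.IsRegular X) (hD : D.IsEffective) [IsReduced hD.idealSheaf.subscheme] {η : X}
    (hη : (D.nonvanishing 1)ᶜ = closure {η}) : hD.idealSheaf = primeDivisorIdeal η := by
  obtain ⟨h1, a, ha, hDa⟩ := hD.exists_sameDivisor_smul_of_support_eq_closure hX hη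
  have hpow : hD.idealSheaf = primeDivisorIdeal η ^ a := hDa.idealSheaf_eq_pow_of_smul_ofIsEffectiveCartier hD _
  calc hD.idealSheaf = hD.idealSheaf.radical := (radical_eq_of_isReduced_subscheme _).symm
    _ = (primeDivisorIdeal η ^ a).radical := by rw [hpow]
    _ = (primeDivisorIdeal η).radical := radical_pow_eq_radical _ ha.ne'
    _ = primeDivisorIdeal η := primeDivisorIdeal_radical η

/-- **`Z(D)` reduced ⇒ `D ≈ [supp D]`**: an effective Cartier divisor with reduced closed subscheme and irreducible support `cl{η}` is, as a
divisor, the prime divisor `[cl η]` — multiplicity one. [cite: Hartshorne1977, II.6 Prop. 6.11 and Remark 6.11.2 (pp. 141–142)] [cite: GortzWedhorn2020, Thm. 11.40 (2)] -/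
theorem IsEffective.sameDivisor_prime_of_isReduced (hX : Scheme.IsRegular X) (hD : D.IsEffective) [IsReduced hD.idealSheaf.subscheme] {η : X}
    (hη : (D.nonvanishing 1)ᶜ = closure {η}) :
    D.SameDivisor (ofIsEffectiveCartier (primeDivisorIdeal η)
      (isEffectiveCartier_primeDivisorIdeal_of_isRegular hX (hD.coheight_eq_one_of_support_eq_closure hX hη))) :=
  SameDivisor.of_idealSheaf_eq hD (isEffective_ofIsEffectiveCartier _ _)
    (by rw [hD.idealSheaf_eq_primeDivisorIdeal_of_isReduced hX hη, idealSheaf_ofIsEffectiveCartier])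

/-- **Two effective Cartier divisors with reduced closed subschemes and the same irreducible support are the same divisor** (both are the
prime divisor of the support). [cite: Hartshorne1977, II.6 Prop. 6.11 and Remark 6.11.2 (pp. 141–142)] [cite: GortzWedhorn2020, Thm. 11.40 (2)] -/
theorem sameDivisor_of_isReduced_of_support_eq (hX : Scheme.IsRegular X) {E₁ E₂ : CartierDivisor X} (h₁ : E₁.IsEffective) (h₂ : E₂.IsEffective)
    [IsReduced h₁.idealSheaf.subscheme] [IsReduced h₂.idealSheaf.subscheme] (hsupp : (E₁.nonvanishing 1)ᶜ = (E₂.nonvanishing 1)ᶜ)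
    (hirr : IsIrreducible (E₁.nonvanishing 1)ᶜ) : E₁.SameDivisor E₂ := by
  have hcl : IsClosed (E₁.nonvanishing 1)ᶜ := (E₁.isOpen_nonvanishing 1).isClosed_compl
  have hη : (E₁.nonvanishing 1)ᶜ = closure {hirr.genericPoint} := (hirr.closure_genericPoint hcl).symm
  refine SameDivisor.of_idealSheaf_eq h₁ h₂ ?_
  rw [h₁.idealSheaf_eq_primeDivisorIdeal_of_isReduced hX hη, h₂.idealSheaf_eq_primeDivisorIdeal_of_isReduced hX (hsupp.symm.trans hη)]

/-- **An effective divisor with reduced `Z(D)` and irreducible support is not a proper multiple**: if `D ≈ m • E` with `E` effective and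
`m ≥ 1` then `m = 1`.  Indeed `E` has the same irreducible support, so `E ≈ b • [cl η]`, `b ≥ 1`, whence `𝓘 = 𝒪(−D) = 𝓘^{b m}` and `b m = 1`
(§1, the stalk at `η`). The principality-free form of «a principal polarisation divisor is not a proper multiple».
[cite: Hartshorne1977, II.6 Prop. 6.11 and Remark 6.11.2 (pp. 141–142)] [cite: Matsumura1987, Thm. 2.2 (Nakayama)] -/
theorem IsEffective.eq_one_of_sameDivisor_smul_of_isReduced (hX : Scheme.IsRegular X) (hD : D.IsEffective)
    [IsReduced hD.idealSheaf.subscheme] (hirr : IsIrreducible (D.nonvanishing 1)ᶜ) {E : CartierDivisor X} (hE : E.IsEffective) {m : ℕ} (hm : 0 < m)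
    (h : D.SameDivisor (m • E)) : m = 1 := by
  have hcl : IsClosed (D.nonvanishing 1)ᶜ := (D.isOpen_nonvanishing 1).isClosed_compl
  set η := hirr.genericPoint with hηdef
  have hη : (D.nonvanishing 1)ᶜ = closure {η} := (hirr.closure_genericPoint hcl).symm
  -- `E` has the same support
  have hsuppE : (E.nonvanishing 1)ᶜ = closure {η} := by
    rw [← hη, h.compl_nonvanishing_one_eq hD (hE.smul m)]
    ext x
    rw [Set.mem_compl_iff, Set.mem_compl_iff, ← avoids_iff_mem_nonvanishing_one, ← avoids_iff_mem_nonvanishing_one,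
      hE.avoids_smul_iff hm.ne']
  -- `E ≈ b • [cl η]`, so `D ≈ (b m) • [cl η]`
  obtain ⟨h1, b, hb, hEb⟩ := hE.exists_sameDivisor_smul_of_support_eq_closure hX hsuppE
  have hDbm : D.SameDivisor ((b * m) • ofIsEffectiveCartier (primeDivisorIdeal η)
      (isEffectiveCartier_primeDivisorIdeal_of_isRegular hX h1)) := by
    have := h.trans (hEb.smul m)
    rwa [smul_smul] at this
  -- ideal sheaves: `𝓘 = 𝓘^{b m}`
  have hI : hD.idealSheaf = primeDivisorIdeal η ^ (b * m) := hDbm.idealSheaf_eq_pow_of_smul_ofIsEffectiveCartier hD _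
  rw [hD.idealSheaf_eq_primeDivisorIdeal_of_isReduced hX hη] at hI
  have hbm : b * m = 1 := primeDivisorIdeal_pow_eq_self_imp h1 (Nat.mul_pos hb hm) hI.symm
  exact Nat.eq_one_of_mul_eq_one_left hbm

end Regular

end CartierDivisor

/-! ## §3 On an abelian variety over a field -/

namespace AbelianVariety

open Literature.AlgebraicGeometry.Resolution

variable {k : Type u} [Field k] (A : AbelianVariety k)

/-- **On an abelian variety, an effective divisor with reduced `Z(D)` and irreducible support is `≈ [supp D]`; two such with the same support
are the same divisor** (abelian varieties are regular ★ `isRegularLocalRing_stalk`, integral, Noetherian ★ `isNoetherian_left`).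
[cite: Hartshorne1977, II.6 Prop. 6.11 and Remark 6.11.2 (pp. 141–142)] -/
theorem sameDivisor_of_isReduced_of_support_eq {E₁ E₂ : CartierDivisor A.X.left} (h₁ : E₁.IsEffective) (h₂ : E₂.IsEffective)
    [IsReduced h₁.idealSheaf.subscheme] [IsReduced h₂.idealSheaf.subscheme] (hsupp : (E₁.nonvanishing 1)ᶜ = (E₂.nonvanishing 1)ᶜ)
    (hirr : IsIrreducible (E₁.nonvanishing 1)ᶜ) : E₁.SameDivisor E₂ := by
  haveI := A.isNoetherian_left
  exact CartierDivisor.sameDivisor_of_isReduced_of_support_eq (fun x => A.isRegularLocalRing_stalk x) h₁ h₂ hsupp hirr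

/-- **On an abelian variety, an effective divisor with reduced `Z(D)` and irreducible support is not a proper multiple of an effective
divisor** — the principality-free twin of ★ `eq_one_of_isPrincipalPolarizationDivisor_smul`. [cite: Hartshorne1977, II.6 Prop. 6.11 and Remark 6.11.2 (pp. 141–142)] -/
theorem eq_one_of_sameDivisor_smul_of_isReduced {D : CartierDivisor A.X.left} (hD : D.IsEffective) [IsReduced hD.idealSheaf.subscheme]
    (hirr : IsIrreducible (D.nonvanishing 1)ᶜ) {E : CartierDivisor A.X.left} (hE : E.IsEffective) {m : ℕ} (hm : 0 < m)
    (h : D.SameDivisor (m • E)) : m = 1 := by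
  haveI := A.isNoetherian_left
  exact hD.eq_one_of_sameDivisor_smul_of_isReduced (fun x => A.isRegularLocalRing_stalk x) hirr hE hm h

/-- **On an abelian variety, `Z(D)` reduced with irreducible support `cl{η}` ⇒ `𝒪_A(−D) = 𝓘_{cl η}`.** [cite: Hartshorne1977, II.6 Prop. 6.11 and Remark 6.11.2 (pp. 141–142)] -/
theorem idealSheaf_eq_primeDivisorIdeal_of_isReduced {D : CartierDivisor A.X.left} (hD : D.IsEffective) [IsReduced hD.idealSheaf.subscheme]
    {η : A.X.left} (hη : (D.nonvanishing 1)ᶜ = closure {η}) : hD.idealSheaf = primeDivisorIdeal η := by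
  haveI := A.isNoetherian_left
  exact hD.idealSheaf_eq_primeDivisorIdeal_of_isReduced (fun x => A.isRegularLocalRing_stalk x) hη

end AbelianVariety

end Literature.AlgebraicGeometry.Motives

end
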